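import Literature.NumberTheory.GaloisRepresentations.HomDualCovariantSequence
import Literature.NumberTheory.GaloisRepresentations.HomDualPresentation
import Literature.Algebra.Module.PDivisibleHomExtension
import Literature.Algebra.Homology.DiscreteRepContinuous
import Mathlib.Algebra.Module.Projective
import HarnessLib

/-!
# The discrete `Γ`-modules `Hom_ℤ(N, M)` over an ARBITRARY topological group `Γ`, their functoriality, and the short
# exactness of `Hom(N, ·)` (N a lattice) and of `Hom(·, A)` (A injective, or A `p`-divisible against a `p`-primary cokernel)

Topic `NumberTheory/GaloisRepresentations`; namespace `Literature.NumberTheory.GaloisRepresentations.ContHomDual`.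
Definitions with bodies (`homContRep`, `precomp`, `postcomp`, `invariantOfEquivariant` — plumbing) and theorems; no named fact,
no instance, no `sorry`.  This is the template `HomDualPresentation` §1–§3 + `HomDualCovariantSequence` §2–§3 + the constructor
`homGaloisModule` (`DiscreteRepExtInternalHomGalois`) RE-TYPED FOR A GENERAL TOPOLOGICAL GROUP `Γ` in place of `Γ_K =
absoluteGaloisGroup K` (their proofs never used more), plus ONE new exactness statement: `isSES_dual_of_pDivisible`
(`Hom(·, A)` is short exact on `0 → X → Y → Z → 0` when `Y` is `ℤ`-free, `Z` is killed by `p^k` and `A` is only `p`-DIVISIBLE —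
`PDivisible.exists_comp_eq_of_pDivisible`, Harari Lemma 17.21 (a)).  At `Γ = Γ_K` everything is definitionally the template's
(`homContRep_eq_homGaloisModule`).

WHY.  The `S`-version of the Poitou–Tate presentation road (background lane «PT-Ш-S-TC» of crux `stmt-BirchSwinnertonDyer-19032`,
bricks D4a–D5, design memo `D4A-DESIGN-w7g11.md`) lives over `Γ := G_S = GaloisGroupUnramifiedOutside K S` with coefficient
module `Ē_S = sUnitsRestricted K S` (`p`-divisible, not divisible): the template's `Γ_K`-typed Hom-module layer and its
`isSES_dual (hW : Module.Baer ℤ W)` do not apply as stated.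

* §1 `homContRep ρN ρ : ContinuousRep Γ ℤ (HomCarrier MN M)` (`(σ·F) = ρ σ ∘ F ∘ ρN σ⁻¹`; stabilisers open by door-c4's
  `isDiscrete_ihom`), `homContRep_apply`, `homContRep_eq_homGaloisModule`;
* §2 `precomp`/`postcomp` (equivariant `F ↦ F ∘ u`, `F ↦ u ∘ F`), `mem_invariants_iff` (invariants = equivariant maps),
  `invariantOfEquivariant`, `postcomp_precomp`;
* §3 `dualF/dualG`, **`isSES_dual`** (Baer `A`), **`isSES_dual_of_pDivisible`** (NEW); `homF/homG`, **`isSES_hom`** (`N` projective).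

HONEST FRAMING: module-theoretic plumbing; no arithmetic and no case of BSD is proved here.

## References
* J. S. Milne, *Arithmetic Duality Theorems* (2nd ed. 2006), I §0 (0.8) (`Hom(M, N)` as a `G`-module), I Lemma 4.13. [MilneADT2006]
* D. Harari, *Galois Cohomology and Class Field Theory* (2020), §16.2 Remark 16.13, Lemma 17.21 (a). [Harari2020]
* C. Weibel, *An Introduction to Homological Algebra* (1994), §2.2, §2.3. [Weibel1994]
-/

noncomputable section

open CategoryTheory
open scoped ContRepresentation

namespace Literature.NumberTheory.GaloisRepresentations

namespace ContHomDual

open Literature.Algebra.Homology Literature.Algebra.Homology.DiscreteRep ContRepresentation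

variable {Γ : Type} [Group Γ] [TopologicalSpace Γ] [IsTopologicalGroup Γ]
variable {MN M : Type} [AddCommGroup MN] [TopologicalSpace MN] [DiscreteTopology MN] [Module.Finite ℤ MN]
  [AddCommGroup M] [TopologicalSpace M] [DiscreteTopology M]

/-! ## §1 `Hom_ℤ(N, M)` as a continuous representation of `Γ` on a discrete module -/

/-- **The discrete `Γ`-module `Hom_ℤ(N, M)`** of two continuous representations on discrete modules with `N` finitely generated:
`(σ·F) = ρ σ ∘ F ∘ ρN σ⁻¹` (Mathlib `Representation.linHom`); the stabilisers are open by door-c4's `isDiscrete_ihom`.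
[cite: MilneADT2006, I §0 (0.8)][cite: Harari2020, §16.2, Remark 16.13] -/
def homContRep (ρN : ContinuousRep Γ ℤ MN) (ρ : ContinuousRep Γ ℤ M) : ContinuousRep Γ ℤ (HomCarrier MN M) :=
  ContinuousRep.ofStabilizerMemNhdsOne (M := HomCarrier MN M) (Representation.linHom ρN.toRepresentation ρ.toRepresentation)
    fun F => (isDiscrete_ihom (ofContinuousRep ρN) (ofContinuousRep ρ) F).mem_nhds (by simp)

/-- Unfolding: `homContRep ρN ρ σ F = ρ σ ∘ F ∘ ρN σ⁻¹`. [cite: MilneADT2006, I §0 (0.8)] -/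
theorem homContRep_apply (ρN : ContinuousRep Γ ℤ MN) (ρ : ContinuousRep Γ ℤ M) (σ : Γ) (F : MN →ₗ[ℤ] M) :
    homContRep ρN ρ σ F = ρ σ ∘ₗ F ∘ₗ ρN σ⁻¹ := rfl

/-- At `Γ = Γ_K` this is the template's `homGaloisModule` (definitionally). [cite: MilneADT2006, I §0 (0.8)] -/
theorem homContRep_eq_homGaloisModule {K : Type} [Field K] (ρN : DiscreteGaloisModule K MN) (ρ : DiscreteGaloisModule K M) :
    homContRep ρN ρ = homGaloisModule ρN ρ := rfl

/-! ## §2 Pre- and post-composition; invariants are the equivariant homomorphisms -/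

section Functoriality

variable {X Y Z W : Type}
  [AddCommGroup X] [TopologicalSpace X] [DiscreteTopology X] [Module.Finite ℤ X]
  [AddCommGroup Y] [TopologicalSpace Y] [DiscreteTopology Y] [Module.Finite ℤ Y]
  [AddCommGroup Z] [TopologicalSpace Z] [DiscreteTopology Z] [Module.Finite ℤ Z]
  [AddCommGroup W] [TopologicalSpace W] [DiscreteTopology W]
variable (ρX : ContinuousRep Γ ℤ X) (ρY : ContinuousRep Γ ℤ Y) (ρZ : ContinuousRep Γ ℤ Z) (ρA : ContinuousRep Γ ℤ W)

/-- **`u^* : Hom(Y, A) → Hom(X, A)`, `F ↦ F ∘ u`, as a continuous equivariant map** for an equivariant `u : X → Y`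
(the template's `HomDual.precomp`, any `Γ`). [cite: MilneADT2006, I §0 (0.8)] -/
def precomp (u : ρX.toContRepresentation →ⁱL ρY.toContRepresentation) :
    (homContRep ρY ρA).toContRepresentation →ⁱL (homContRep ρX ρA).toContRepresentation where
  toLinearMap := (HomDual.precompAddHom (W := W) u.toContinuousLinearMap.toLinearMap).toIntLinearMap
  cont := continuous_of_discreteTopology
  isIntertwining' σ := by
    refine ContinuousLinearMap.ext fun F => ?_
    refine LinearMap.ext fun x => ?_
    change (show Y →ₗ[ℤ] W from homContRep ρY ρA σ F) (u x) =
      (show X →ₗ[ℤ] W from homContRep ρX ρA σ (HomDual.precompAddHom (W := W) u.toLinearMap F)) x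
    rw [homContRep_apply, homContRep_apply]
    change ρA σ ((show Y →ₗ[ℤ] W from F) (ρY σ⁻¹ (u x))) =
      ρA σ ((show Y →ₗ[ℤ] W from F) (u (ρX σ⁻¹ x)))
    have hu : u.toContinuousLinearMap (ρX σ⁻¹ x) = ρY σ⁻¹ (u.toContinuousLinearMap x) := by
      simpa [ContinuousRep.toContRepresentation_apply_apply] using congr($(u.isIntertwining' σ⁻¹) x)
    exact congrArg (fun y => ρA σ ((show Y →ₗ[ℤ] W from F) y)) hu.symm

omit [Module.Finite ℤ X] [Module.Finite ℤ Y] in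
/-- Unfolding: `precomp u F = F ∘ u`. [cite: MilneADT2006, I §0 (0.8)] -/
@[simp] theorem precomp_apply_apply [Module.Finite ℤ X] [Module.Finite ℤ Y]
    (u : ρX.toContRepresentation →ⁱL ρY.toContRepresentation) (F : HomCarrier Y W) (x : X) :
    (show X →ₗ[ℤ] W from precomp ρX ρY ρA u F) x = (show Y →ₗ[ℤ] W from F) (u x) := rfl

/-- **`u_* : Hom(N, Y) → Hom(N, Z)`, `F ↦ u ∘ F`, as a continuous equivariant map** for an equivariant `u : Y → Z`
(the template's `HomDual.postcomp`, any `Γ`). [cite: MilneADT2006, I §0 (0.8)] -/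
def postcomp (u : ρY.toContRepresentation →ⁱL ρZ.toContRepresentation) :
    (homContRep ρX ρY).toContRepresentation →ⁱL (homContRep ρX ρZ).toContRepresentation where
  toLinearMap := (HomDual.postcompCarrier (N := X) u.toContinuousLinearMap.toLinearMap).toIntLinearMap
  cont := continuous_of_discreteTopology
  isIntertwining' σ := by
    refine ContinuousLinearMap.ext fun F => ?_
    refine LinearMap.ext fun x => ?_
    change u ((show X →ₗ[ℤ] Y from homContRep ρX ρY σ F) x) =
      (show X →ₗ[ℤ] Z from homContRep ρX ρZ σ (HomDual.postcompCarrier (N := X) u.toLinearMap F)) x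
    rw [homContRep_apply, homContRep_apply]
    change u.toContinuousLinearMap (ρY σ ((show X →ₗ[ℤ] Y from F) (ρX σ⁻¹ x))) =
      ρZ σ (u.toContinuousLinearMap ((show X →ₗ[ℤ] Y from F) (ρX σ⁻¹ x)))
    simpa [ContinuousRep.toContRepresentation_apply_apply] using
      congr($(u.isIntertwining' σ) ((show X →ₗ[ℤ] Y from F) (ρX σ⁻¹ x)))

omit [Module.Finite ℤ Y] [Module.Finite ℤ Z] in
/-- Unfolding: `postcomp u F = u ∘ F`. [cite: MilneADT2006, I §0 (0.8)] -/
@[simp] theorem postcomp_apply_apply (u : ρY.toContRepresentation →ⁱL ρZ.toContRepresentation)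
    (F : HomCarrier X Y) (x : X) :
    (show X →ₗ[ℤ] Z from postcomp ρX ρY ρZ u F) x = u ((show X →ₗ[ℤ] Y from F) x) := rfl

omit [Module.Finite ℤ Z] in
/-- `postcomp` commutes with `precomp`: `u ∘ (F ∘ w) = (u ∘ F) ∘ w`. [cite: MilneADT2006, I §0 (0.8)] -/
theorem postcomp_precomp (w : ρX.toContRepresentation →ⁱL ρY.toContRepresentation)
    (u : ρZ.toContRepresentation →ⁱL ρA.toContRepresentation) (F : HomCarrier Y Z) :
    postcomp ρX ρZ ρA u (precomp ρX ρY ρZ w F) = precomp ρX ρY ρA w (postcomp ρY ρZ ρA u F) := rfl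

omit [Module.Finite ℤ X] in
/-- **`F ∈ Hom(X, A)^Γ` iff `F` is `Γ`-equivariant.** [cite: MilneADT2006, I §0 (0.8)] -/
theorem mem_invariants_iff [Module.Finite ℤ X] (F : HomCarrier X W) :
    F ∈ (homContRep ρX ρA).toTopRep.ρ.invariants ↔
      ∀ (σ : Γ) (x : X), (show X →ₗ[ℤ] W from F) (ρX σ x) = ρA σ ((show X →ₗ[ℤ] W from F) x) := by
  constructor
  · intro hF σ x
    have h := hF σ
    change homContRep ρX ρA σ F = F at h
    rw [homContRep_apply] at h
    have hx := LinearMap.congr_fun h (ρX σ x)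
    simp only [LinearMap.coe_comp, Function.comp_apply] at hx
    rw [← hx, ← Module.End.mul_apply, ← map_mul, inv_mul_cancel, map_one, Module.End.one_apply]
  · intro hF σ
    change homContRep ρX ρA σ F = F
    rw [homContRep_apply]
    refine LinearMap.ext fun x => ?_
    simp only [LinearMap.coe_comp, Function.comp_apply]
    rw [← hF, ← Module.End.mul_apply, ← map_mul, mul_inv_cancel, map_one, Module.End.one_apply]

/-- An equivariant homomorphism as an invariant of `Hom(X, A)`. [cite: MilneADT2006, I §0 (0.8)] -/
def invariantOfEquivariant (F : X →ₗ[ℤ] W) (hF : ∀ (σ : Γ) (x : X), F (ρX σ x) = ρA σ (F x)) :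
    (homContRep ρX ρA).toTopRep.ρ.invariants :=
  ⟨F, (mem_invariants_iff ρX ρA F).2 hF⟩

/-- Unfolding. [cite: MilneADT2006, I §0 (0.8)] -/
@[simp] theorem coe_invariantOfEquivariant (F : X →ₗ[ℤ] W) (hF : ∀ (σ : Γ) (x : X), F (ρX σ x) = ρA σ (F x)) :
    (invariantOfEquivariant ρX ρA F hF : HomCarrier X W) = F := rfl

/-! ## §3 Short exactness of `Hom(·, A)` and of `Hom(N, ·)` -/

variable (i : ρX.toContRepresentation →ⁱL ρY.toContRepresentation) (p : ρY.toContRepresentation →ⁱL ρZ.toContRepresentation)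

/-- `p^* : Hom(Z, A) ⟶ Hom(Y, A)` in `TopRep`. [cite: MilneADT2006, I §0 (0.8)] -/
abbrev dualF : (homContRep ρZ ρA).toTopRep ⟶ (homContRep ρY ρA).toTopRep := TopRep.ofHom (precomp ρY ρZ ρA p)

/-- `i^* : Hom(Y, A) ⟶ Hom(X, A)` in `TopRep`. [cite: MilneADT2006, I §0 (0.8)] -/
abbrev dualG : (homContRep ρY ρA).toTopRep ⟶ (homContRep ρX ρA).toTopRep := TopRep.ofHom (precomp ρX ρY ρA i)

/-- The three exactness properties of the dual sequence that hold for ANY `A` (composite zero, injectivity of `p^*`,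
exactness in the middle). [cite: Weibel1994, §2.3][cite: MilneADT2006, I §0 (0.8)] -/
theorem dual_exact_left (hS : IsSES (TopRep.ofHom i : ρX.toTopRep ⟶ ρY.toTopRep) (TopRep.ofHom p : ρY.toTopRep ⟶ ρZ.toTopRep)) :
    dualF ρY ρZ ρA p ≫ dualG ρX ρY ρA i = 0 ∧ Function.Injective (dualF ρY ρZ ρA p).hom ∧
      ∀ G : HomCarrier Y W, (dualG ρX ρY ρA i).hom G = 0 → ∃ F, (dualF ρY ρZ ρA p).hom F = G := by
  refine ⟨?_, ?_, ?_⟩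
  · apply TopRep.hom_ext
    rw [TopRep.hom_comp, TopRep.hom_zero]
    refine DFunLike.ext _ _ fun F => ?_
    change (show X →ₗ[ℤ] W from precomp ρX ρY ρA i (precomp ρY ρZ ρA p F)) = (0 : X →ₗ[ℤ] W)
    refine LinearMap.ext fun x => ?_
    change (show Z →ₗ[ℤ] W from F) (p (i x)) = 0
    have h0 : p (i x) = 0 := hS.g_f_apply x
    rw [h0, map_zero]
  · intro F F' h
    have h' : (show Y →ₗ[ℤ] W from precomp ρY ρZ ρA p F) = (show Y →ₗ[ℤ] W from precomp ρY ρZ ρA p F') := h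
    change (show Z →ₗ[ℤ] W from F) = (show Z →ₗ[ℤ] W from F')
    refine LinearMap.ext fun z => ?_
    obtain ⟨y, rfl⟩ := hS.surjective z
    exact LinearMap.congr_fun h' y
  · intro G hG
    have hG' : (show X →ₗ[ℤ] W from precomp ρX ρY ρA i G) = (0 : X →ₗ[ℤ] W) := hG
    have hker : LinearMap.ker p.toContinuousLinearMap.toLinearMap ≤ LinearMap.ker (show Y →ₗ[ℤ] W from G) := by
      intro y hy
      obtain ⟨x, rfl⟩ := hS.exact_mid y hy
      exact LinearMap.congr_fun hG' x
    refine ⟨(((LinearMap.ker p.toContinuousLinearMap.toLinearMap).liftQ (show Y →ₗ[ℤ] W from G) hker) ∘ₗ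
      (p.toContinuousLinearMap.toLinearMap.quotKerEquivOfSurjective hS.surjective).symm.toLinearMap : Z →ₗ[ℤ] W), ?_⟩
    change (show Y →ₗ[ℤ] W from precomp ρY ρZ ρA p _) = (show Y →ₗ[ℤ] W from G)
    refine LinearMap.ext fun y => ?_
    change ((LinearMap.ker p.toContinuousLinearMap.toLinearMap).liftQ (show Y →ₗ[ℤ] W from G) hker)
      ((p.toContinuousLinearMap.toLinearMap.quotKerEquivOfSurjective hS.surjective).symm
        (p.toContinuousLinearMap.toLinearMap y)) = (show Y →ₗ[ℤ] W from G) y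
    rw [LinearMap.quotKerEquivOfSurjective_symm_apply, Submodule.liftQ_apply]

/-- **The dual of a short exact sequence against a Baer (injective) module `A` is short exact**:
`0 → Hom(Z, A) → Hom(Y, A) → Hom(X, A) → 0` (the template's `HomDual.isSES_dual`, any `Γ`).
[cite: Weibel1994, §2.3][cite: MilneADT2006, I §0 (0.8)] -/
theorem isSES_dual (hS : IsSES (TopRep.ofHom i : ρX.toTopRep ⟶ ρY.toTopRep) (TopRep.ofHom p : ρY.toTopRep ⟶ ρZ.toTopRep))
    (hW : Module.Baer ℤ W) : IsSES (dualF ρY ρZ ρA p) (dualG ρX ρY ρA i) where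
  comp_eq_zero := (dual_exact_left ρX ρY ρZ ρA i p hS).1
  injective := (dual_exact_left ρX ρY ρZ ρA i p hS).2.1
  exact_mid := (dual_exact_left ρX ρY ρZ ρA i p hS).2.2
  surjective := by
    intro h
    obtain ⟨F, hF⟩ := hW.extension_property i.toContinuousLinearMap.toLinearMap hS.injective (show X →ₗ[ℤ] W from h)
    exact ⟨(F : HomCarrier Y W), hF⟩

/-- **The dual of a short exact sequence `0 → X → Y → Z → 0` with `Y` free over `ℤ` and `Z` killed by `p^k`, against a
`p`-DIVISIBLE `A`, is short exact** (surjectivity of `Hom(Y, A) → Hom(X, A)` = `Ext¹_ℤ(Z, A) = 0`,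
`PDivisible.exists_comp_eq_of_pDivisible`; Harari Lemma 17.21 (a) for `A = E_S`, `S ⊇ S_p`).
[cite: Harari2020, Lemma 17.21 (a) (proof)][cite: MilneADT2006, I §0 (0.8)] -/
theorem isSES_dual_of_pDivisible [Module.Free ℤ Y] {q : ℕ} (hq : q.Prime) {k : ℕ} (hZ : ∀ z : Z, q ^ k • z = 0)
    (hW : ∀ w : W, ∃ w', w = q • w')
    (hS : IsSES (TopRep.ofHom i : ρX.toTopRep ⟶ ρY.toTopRep) (TopRep.ofHom p : ρY.toTopRep ⟶ ρZ.toTopRep)) :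
    IsSES (dualF ρY ρZ ρA p) (dualG ρX ρY ρA i) where
  comp_eq_zero := (dual_exact_left ρX ρY ρZ ρA i p hS).1
  injective := (dual_exact_left ρX ρY ρZ ρA i p hS).2.1
  exact_mid := (dual_exact_left ρX ρY ρZ ρA i p hS).2.2
  surjective := by
    intro h
    obtain ⟨g, hg⟩ := Literature.Algebra.Module.PDivisible.exists_comp_eq_of_pDivisible hq
      i.toContinuousLinearMap.toLinearMap.toAddMonoidHom p.toContinuousLinearMap.toLinearMap.toAddMonoidHom
      hS.injective (fun y hy => hS.exact_mid y hy) hZ hW (show X →ₗ[ℤ] W from h).toAddMonoidHom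
    refine ⟨(g.toIntLinearMap : HomCarrier Y W), ?_⟩
    change (show X →ₗ[ℤ] W from precomp ρX ρY ρA i (g.toIntLinearMap : HomCarrier Y W)) = (show X →ₗ[ℤ] W from h)
    refine LinearMap.ext fun x => ?_
    exact DFunLike.congr_fun hg x

/-- `i_* : Hom(N, X) ⟶ Hom(N, Y)` in `TopRep`. [cite: MilneADT2006, I §0 (0.8)] -/
abbrev homF : (homContRep ρX ρY).toTopRep ⟶ (homContRep ρX ρZ).toTopRep := TopRep.ofHom (postcomp ρX ρY ρZ p)

omit [Module.Finite ℤ Y] [Module.Finite ℤ Z] in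
/-- **`Hom(N, ·)` of a short exact sequence of discrete `Γ`-modules is short exact for `N` projective over `ℤ`**:
`0 → Hom_ℤ(N, Y) → Hom_ℤ(N, Z) → Hom_ℤ(N, A) → 0` for `0 → Y → Z → A → 0` (the template's `HomDual.isSES_hom`, any `Γ`;
exactness on the right is the lifting property of `N`). [cite: Weibel1994, §2.2][cite: MilneADT2006, I §0 (0.8)] -/
theorem isSES_hom [Module.Projective ℤ X] (u : ρZ.toContRepresentation →ⁱL ρA.toContRepresentation)
    (hS : IsSES (TopRep.ofHom p : ρY.toTopRep ⟶ ρZ.toTopRep) (TopRep.ofHom u : ρZ.toTopRep ⟶ ρA.toTopRep)) :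
    IsSES (TopRep.ofHom (postcomp ρX ρY ρZ p) : (homContRep ρX ρY).toTopRep ⟶ (homContRep ρX ρZ).toTopRep)
      (TopRep.ofHom (postcomp ρX ρZ ρA u) : (homContRep ρX ρZ).toTopRep ⟶ (homContRep ρX ρA).toTopRep) where
  comp_eq_zero := by
    apply TopRep.hom_ext
    rw [TopRep.hom_comp, TopRep.hom_zero]
    refine DFunLike.ext _ _ fun F => ?_
    change (show X →ₗ[ℤ] W from postcomp ρX ρZ ρA u (postcomp ρX ρY ρZ p F)) = (0 : X →ₗ[ℤ] W)
    refine LinearMap.ext fun x => ?_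
    change u (p ((show X →ₗ[ℤ] Y from F) x)) = 0
    exact hS.g_f_apply _
  injective := by
    intro F F' h
    have h' : (show X →ₗ[ℤ] Z from postcomp ρX ρY ρZ p F) = (show X →ₗ[ℤ] Z from postcomp ρX ρY ρZ p F') := h
    change (show X →ₗ[ℤ] Y from F) = (show X →ₗ[ℤ] Y from F')
    refine LinearMap.ext fun x => hS.injective ?_
    exact LinearMap.congr_fun h' x
  exact_mid := by
    intro G hG
    have hG' : (show X →ₗ[ℤ] W from postcomp ρX ρZ ρA u G) = (0 : X →ₗ[ℤ] W) := hG
    have hker : ∀ x, u ((show X →ₗ[ℤ] Z from G) x) = 0 := fun x => LinearMap.congr_fun hG' x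
    let F : X →+ Y := AddMonoidHom.mk' (fun x => hS.inv ((show X →ₗ[ℤ] Z from G) x)) fun x y =>
      hS.injective (by
        rw [hS.f_inv (hker _), map_add (show X →ₗ[ℤ] Z from G), map_add, hS.f_inv (hker _), hS.f_inv (hker _)])
    refine ⟨(F.toIntLinearMap : HomCarrier X Y), ?_⟩
    change (show X →ₗ[ℤ] Z from postcomp ρX ρY ρZ p (F.toIntLinearMap : HomCarrier X Y)) = (show X →ₗ[ℤ] Z from G)
    refine LinearMap.ext fun x => ?_
    exact hS.f_inv (hker x)
  surjective := by
    intro H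
    obtain ⟨F, hF⟩ := Module.projective_lifting_property u.toContinuousLinearMap.toLinearMap
      (show X →ₗ[ℤ] W from H) hS.surjective
    exact ⟨(F : HomCarrier X Z), LinearMap.ext fun x => LinearMap.congr_fun hF x⟩

end Functoriality

end ContHomDual

end Literature.NumberTheory.GaloisRepresentations
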